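import Literature.Computability.MetaComplexity.ChenJinWilliams2019.SparseConstantDepthMagnification
import Literature.Computability.Complexity.CircuitInputMap
import Literature.Computability.Complexity.CircuitClassesProofs
import HarnessLib

/-!
# Chen–Tell (STOC 2019): hardness magnification for the `NC¹`-complete word problem over `S₅` in
`TC⁰` (size = wires), with the Impagliazzo–Paturi–Saks known bound — census row R44

Typed statements (a named fact is a `def … : Prop`; OPEN or unproved statements are never
asserted) for the ninth same-model magnification gap of the census
(`Literature.Computability.MetaComplexity.MagnificationGapCensus`, row R44), in the model
`ChenJinWilliams2019.TCdWIRESae d s` already used for rows R49/R31: circuit families over linear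
threshold gates (`ltfBasis`), `acDepth ≤ d` (negations free), at most `s n` WIRES (`Circuit.wires`,
total fan-in) at every sufficiently large length.

* THRESHOLD side [ChenTell2019] (full version dated 24 Nov 2018, lit key `paper:url-8c39e6fb6e2b`;
  PDF pages): model, §3.1 p. 13 "The size of a circuit is the number of wires in the circuit",
  Def. 12 p. 14 "A linear threshold function (LTF) is a function … `Φ(x) = sgn(⟨x, w⟩ − θ)`, where
  `w ∈ ℝⁿ` and `θ ∈ ℝ` … The class `TC⁰` is the class of constant-depth circuit families with
  polynomially-many LTF gates with unbounded fan-in. Note that AND, OR, and NOT are specific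
  instances of LTFs"; the problems, §3.2.1 pp. 15–16 (`monoidPairs`, `WS5`). Theorem 2 (p. 5):
  "Fix any problem `Π ∈ {BFE, W_{S5}, W5-STCONN}`. Then, for any `d₀, k ∈ ℕ` there exists `c > 1`
  such that the following holds. If for infinitely many constants `d ∈ ℕ` the problem `Π` cannot be
  solved by `TC⁰` circuits of depth `d` and `n^{1+c^{−d}}` wires, then the problem `Π` cannot be
  solved by `TC⁰` circuits of depth `d₀` and `n^k` wires." (`thm2`); Corollary 3 (p. 5): "Fix any
  problem `Π ∈ {BFE, W_{S5}, W5-STCONN}`. Assume that for every `c > 1` there exist infinitely many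
  `d ∈ ℕ` such that `TC⁰` circuits of depth `d` need more than `n^{1+c^{−d}}` wires to solve the
  problem `Π`. Then, `TC⁰ ≠ NC¹`." (`cor3`); Corollary 21 (p. 20, the explicit constant): "Let `Π` be
  either the `W_{S5}` problem or the `W5-STCONN` problem. Assume that `Π` can be computed by `TC⁰`
  circuits of depth `d₀` and size `n^k`. Then, for every sufficiently large constant `d ∈ ℕ` it holds
  that `Π` can be computed by `TC⁰` circuits of depth `d` and size `n^{1+2e³·c^{−d}}`, where
  `c = e^{1/(k·d₀)}`." with the note "for any `c′ < e^{1/(k·d₀)}`, for every sufficiently large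
  `d ∈ ℕ` it holds that `W_{S5}` can be computed by `TC⁰` circuits of depth `d` and size
  `n^{1+(c′)^{−d}}`" (`cor21`).
* KNOWN side [ImpagliazzoPaturiSaks1997] (SIAM J. Comput. 26(3), lit key
  `paper:doi-10-1137-s0097539792282965`), §6 p. 703: "define `νᵢ` for `i ≥ 1` to be the solution
  to the recurrence equation `ν_{i+2} = 2ν_{i+1} + νᵢ` with the initial conditions `ν₁ = 1` and
  `ν₂ = 3` … `νᵢ ∈ Θ((1+√2)^i)`", Corollary 4: "Any threshold circuit of depth `d ≥ 2` that
  computes parity of `n` variables has at least `(n/11)^{1+1/(ν_d−1)}` edges." (`nu`, `ips97_cor4`);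
  [ChenTell2019, p. 5]: "`TC⁰` circuits of constant depth `d ∈ ℕ` require `n^{1+Ω(c^{−d})}` wires,
  where `c = 1+√2 ≈ 2.41`, in order to compute various `NC¹`-complete functions … (`W_{S5}`) …",
  fn. 5: "computing parity can be reduced to computing any of these functions with a linear
  overhead; see [AK10, Sec. 1.2]". The transfer to `W_{S5}` is PROVED here for a concrete encoding
  `bin₀` (`WS5_not_mem_of_ips97`, `WS5_not_mem_rpow_of_ips97`), so no constant is minted: the
  `IPS97` exponents `1 + e`, `e < 1/(ν_d − 1)`, against the Chen–Tell thresholds `1 + c^{−d}`;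
  `nu_closed`, `inv_pow_lt_one_div_nu` and `eventually_one_div_nu_lt_inv_pow` locate the base
  `1 + √2` exactly (the census block draws the conclusion).

## Modelling decisions (every typed fact is implied by the printed one)

1. DECISION VERSION. Chen–Tell work with the functional monoid problem (`ℓ` output bits) and note
   (p. 15–16): "The formal presentation of the monoid problem that makes these problems complete is
   as a set of pairs `((σ₁, …, σ_n), σ) ⊆ {0,1}*` such that `∏_{i∈[n]} σᵢ = σ`; yet, the complexity of the
   latter version of the problem is essentially identical to that of the functional version … Since
   the problems remain complete under any injective encoding `Bin`, we suppress `Bin`". Our circuits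
   (`Circuit`) have one output, so we type the PAIRS language `monoidPairs`/`WS5 Bin` for an
   arbitrary injective `Bin : S₅ ↪ {0,1}⁷` (`ℓ = ⌈log₂ 120⌉ = 7`). The two versions convert into
   each other with constant overhead: decision circuits of depth `d₀` and `n^k` wires give functional
   circuits of depth `d₀ + 1` and `≤ 240·n^k + 840 ≤ n^{k+1}` wires (hard-wire the last block to each
   of the 120 codes — constants fold into thresholds — and OR the answers bitwise); functional
   circuits of depth `d` and `W(n)` wires give decision circuits of depth `d + 2` and `W + O(n)` wires
   (compare the output with the last block by `2·7` threshold gates, AND with a linear-size validity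
   check of every block). In `thm2`/`cor3` the constant `c` is existential, so these shifts are
   invisible (print at `(d₀+1, k+1)` gives ours at `(d₀, k)`, with any `1 < c < c_print`, since
   `n^{1+c_print^{−d}} + O(n) ≤ n^{1+c^{−(d+2)}}` for large `d, n`); in `cor21` they are explicit:
   the admissible bases are `c′ < e^{1/((k+1)(d₀+1))}`.
2. GATES AND DEPTH. Integer-weight LTF gates (`GateFn.IsLTF`) are exactly the real-weight LTFs on
   Boolean inputs; repeated arguments of a gate merge (fewer wires). Print counts a NOT gate as an
   LTF gate of depth one, we count it depth-free (`acDepth`): a print circuit is one of ours with the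
   same wires and `acDepth ≤ depth`; conversely negation gates are absorbed into the weights of the
   gates they feed (an output negation is replaced by the complementary LTF), giving a print circuit
   of depth `= acDepth` and at most twice the wires — absorbed by `k ↦ k+1` resp. `c ↦ c′ < c` as in 1.
3. FAMILIES (a.e. rendering; referee finding F23). Print's "can be solved by `TC⁰` circuits of
   depth `d` and `n^{1+c^{−d}}` wires" speaks of a circuit family at EVERY length; we read both the
   hypothesis and the conclusion of Thm. 2 / Cor. 3 / Cor. 21 in the almost-everywhere class
   `TCdWIRESae d ⌊n^{1+c^{−d}}⌋₊` (as in rows R48/R49; wire counts are integers, so `⌊·⌋` loses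
   nothing). Because the typed HYPOTHESIS of `cor21` (circuits correct at all sufficiently large
   lengths) is weaker than the printed every-length hypothesis, `cor21`/`thm2` as typed are implied
   NOT by the printed statements verbatim but BY THE PRINTED PROOF: the self-reduction of Theorem 19
   (pp. 18–19; Cor. 20–21, pp. 19–20) evaluates the hypothesised depth-`d₀` circuits only at block
   lengths `n^{Ω(1)}` (at most `d` levels of blocks of length `≈ n^{(1−1/k)^i}`), which exceed any
   fixed threshold once `n` is large, and it outputs circuits for every sufficiently large `n`; so an
   almost-everywhere hypothesis family yields an almost-everywhere conclusion family by the same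
   argument. This is the only place where a typed fact leans on a printed proof rather than a
   printed statement, and the docstrings of `thm2`, `cor21` (and their `W_{S5}` instances) say so.
4. `TC⁰ ≠ NC¹` is rendered with the tree's classes `TC0` (majority gates, size = gates) and `NC1`;
   LTF-`TC⁰` = MAJ-`TC⁰` by [GoldmannKarpinski1998] (cited for this purpose in Def. 12).
5. IPS97. Their circuits (p. 695) are DAGs of real threshold gates, edges = wires, depth = level of
   the output; §6 is "stated for layered threshold circuits … an arbitrary threshold circuit can be
   converted to a layered one … increasing the number of edges by a factor of at most `d`" (p. 703).
   `ips97_cor4` is therefore stated for our (unlayered, negation-free-depth) circuits with the factor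
   `2·d` (`2` for absorbing negations as in 2., `d` for layering), for `acDepth ≤ d` and `n ≥ 11`
   (the bound is decreasing in `d` since `ν` is nondecreasing and `n/11 ≥ 1`; a circuit of
   `acDepth ≤ 1` is a threshold gate of literals up to negation and does not compute parity of
   `n ≥ 2` variables, so nothing is claimed below depth `2`). `ν₀ := 1` extends the recurrence
   backwards (`ν₂ = 2ν₁ + ν₀`) and is never used.

Everything not marked as a named fact is proved ([folklore] = routine). No `sorry`, no axioms.
Deliberately NOT here: `W5-STCONN` (the monoid of `5×5` Boolean matrices under the `(∨,∧)` product)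
and `BFE`, for which print states the same Theorem 2 / Corollary 3; the functional version of the
monoid problem; IPS97's restriction theorem (Thm. 3) behind Cor. 4; any value of the constant in
Theorem 2 beyond Corollary 21. LOGICAL FORM: since `c` is existential, `thm2 L` is (classically)
the statement `(∀ c > 1, HardAtBase L c) → ∀ d₀ k, L ∉ TC_{d₀}[n^k]`; the dependence
`c = c(k, d₀)` that makes Theorem 2 quantitative is exactly `cor21` (`thm2_of_cor21`).

## References

* L. Chen, R. Tell, *Bootstrapping results for threshold circuits "just beyond" known lower
  bounds*, STOC 2019, 34–41; full version 24 Nov 2018 [ChenTell2019].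
* R. Impagliazzo, R. Paturi, M. E. Saks, *Size–depth tradeoffs for threshold circuits*, SIAM J.
  Comput. 26(3) (1997) 693–707, §6, Cor. 4 [ImpagliazzoPaturiSaks1997].
* D. A. Barrington, *Bounded-width polynomial-size branching programs recognize exactly those
  languages in NC¹*, JCSS 38 (1989) [Barrington1989] (the word problem over `S₅` is `NC¹`-complete).
* E. Allender, M. Koucký, *Amplifying lower bounds by means of self-reducibility*, J. ACM 57(3)
  (2010), §1.2 [AllenderKoucky2010] (parity reduces to the word problem with linear overhead).
* M. Goldmann, M. Karpinski, *Simulating threshold circuits by majority circuits*, SIAM J. Comput.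
  27(1) (1998) [GoldmannKarpinski1998].
-/

noncomputable section

namespace Literature.Computability.MetaComplexity.ChenTell2019

open Finset Filter
open Literature.Computability.Complexity
open Literature.Computability.MetaComplexity Literature.Computability.MetaComplexity.ChenJinWilliams2019

/-! ### The monoid problem in its pairs presentation; the word problem over `S₅` -/

/-- The code of a tuple of monoid elements: the concatenation of their `ℓ`-bit codes
`(Bin σ₀, …, Bin σ_{m-1})`. [cite: ChenTell2019, §3.2.1 (p. 15: "x = (Bin(σ₁), …, Bin(σ_n))")] -/
def encode {M : Type*} {ℓ : ℕ} (Bin : M → (Fin ℓ → Bool)) {m : ℕ} (g : Fin m → M) : List Bool :=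
  (List.ofFn fun i => List.ofFn (Bin (g i))).flatten

/-- **The monoid problem for `(M, Bin)`, pairs presentation**: the strings
`Bin σ₀ ⋯ Bin σ_{m-1} Bin σ` (`m ≥ 0` elements followed by one target, all `ℓ`-bit codes) with
ordered product `σ₀ ⋯ σ_{m-1} = σ`. Strings that do not parse are outside.
[cite: ChenTell2019, §3.2.1 (pp. 15–16: "a set of pairs ((σ₁, …, σ_n), σ) ⊆ {0,1}* such that
∏_{i∈[n]} σᵢ = σ")] -/
def monoidPairs (M : Type*) [Monoid M] (ℓ : ℕ) (Bin : M → (Fin ℓ → Bool)) : Language Bool :=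
  {w | ∃ (m : ℕ) (g : Fin (m + 1) → M), w = encode Bin g ∧
    (List.ofFn fun i : Fin m => g (Fin.castSucc i)).prod = g (Fin.last m)}

/-- The symmetric group `S₅`. [cite: ChenTell2019, §3.2.1 (p. 16: "the symmetric group S5")] -/
abbrev S5 : Type := Equiv.Perm (Fin 5)

/-- **The word problem over `S₅`** (`W_{S5}`) with the injective encoding `Bin : S₅ → {0,1}⁷`
(`ℓ = ⌈log₂ |S₅|⌉ = ⌈log₂ 120⌉ = 7`), pairs presentation: sequences of permutations followed by
their claimed composition. [cite: ChenTell2019, §3.2.1 (p. 16: "the input is a sequence of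
permutations σ₁, …, σ_n ∈ S5, and the output is their composition σ₁ ∘ … ∘ σ_n")] -/
def WS5 (Bin : S5 → (Fin 7 → Bool)) : Language Bool := monoidPairs S5 7 Bin

/-- `ℓ = 7` is the code length `⌈log₂ |S₅|⌉` of the paper: `2⁶ < |S₅| = 120 ≤ 2⁷`. [folklore] -/
theorem card_S5 : Fintype.card S5 = 120 := by
  rw [Fintype.card_perm, Fintype.card_fin]; rfl

/-! ### Chen–Tell's magnification theorems (threshold side; named facts) -/

/-- The wire bound `n ↦ ⌊n^{1 + c^{−d}}⌋` of [ChenTell2019, Thm. 2 / Cor. 3].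
[cite: ChenTell2019, Thm. 2 (p. 5: "n^{1+c^{−d}} wires")] -/
def wireBound (c : ℝ) (d : ℕ) (n : ℕ) : ℕ := ⌊(n : ℝ) ^ (1 + c⁻¹ ^ d)⌋₊

/-- "for infinitely many constants `d ∈ ℕ` the problem `Π` cannot be solved by `TC⁰` circuits of
depth `d` and `n^{1+c^{−d}}` wires" (at base `c`), in the model `TCdWIRESae`.
[cite: ChenTell2019, Thm. 2 (hypothesis, p. 5)] -/
def HardAtBase (L : Language Bool) (c : ℝ) : Prop :=
  ∀ D : ℕ, ∃ d ≥ D, L ∉ TCdWIRESae d (wireBound c d)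

/-- **[ChenTell2019, Theorem 2]** for the problem `Π` (print: `Π ∈ {BFE, W_{S5}, W5-STCONN}`,
functional version; see the module docstring, items 1–3, for why the pairs version at `(d₀, k)`
follows from print at `(d₀+1, k+1)`): "for any `d₀, k ∈ ℕ` there exists `c > 1` such that the
following holds. If for infinitely many constants `d ∈ ℕ` the problem `Π` cannot be solved by `TC⁰`
circuits of depth `d` and `n^{1+c^{−d}}` wires, then the problem `Π` cannot be solved by `TC⁰`
circuits of depth `d₀` and `n^k` wires." A named fact, used as a hypothesis `(h : thm2 Π)`.
Almost-everywhere rendering of hypothesis and conclusion: implied by the printed PROOF (Thm. 19,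
pp. 18–19), not by the printed every-length statement verbatim — module docstring, item 3 (F23).
[cite: ChenTell2019, Thm. 2 (p. 5); proof via Thm. 19 (pp. 18–19)] -/
def thm2 (L : Language Bool) : Prop :=
  ∀ d₀ k : ℕ, ∃ c : ℝ, 1 < c ∧ (HardAtBase L c → L ∉ TCdWIRESae d₀ fun n => n ^ k)

/-- **[ChenTell2019, Theorem 2] for `W_{S5}`**, every injective encoding (p. 16: "the problems
remain complete under any injective encoding Bin"). Named fact; a.e. rendering implied by the
printed proof (Thm. 19), module docstring item 3. [cite: ChenTell2019, Thm. 2 (p. 5,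
Π = W_{S5}); proof via Thm. 19 (pp. 18–19)] -/
def thm2_WS5 : Prop := ∀ Bin : S5 ↪ (Fin 7 → Bool), thm2 (WS5 Bin)

/-- **[ChenTell2019, Corollary 3]** for `Π`: "Assume that for every `c > 1` there exist infinitely
many `d ∈ ℕ` such that `TC⁰` circuits of depth `d` need more than `n^{1+c^{−d}}` wires to solve the
problem `Π`. Then, `TC⁰ ≠ NC¹`." (`TC0`, `NC1` of `ConstantDepth`; module docstring item 4.)
Named fact. [cite: ChenTell2019, Cor. 3 (p. 5)] -/
def cor3 (L : Language Bool) : Prop := (∀ c : ℝ, 1 < c → HardAtBase L c) → TC0 ≠ NC1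

/-- **[ChenTell2019, Corollary 3] for `W_{S5}`**, every injective encoding. Named fact.
[cite: ChenTell2019, Cor. 3 (p. 5, Π = W_{S5})] -/
def cor3_WS5 : Prop := ∀ Bin : S5 ↪ (Fin 7 → Bool), cor3 (WS5 Bin)

/-- **[ChenTell2019, Corollary 21 and the note after it]** for `Π`, pairs version: if `Π` has `TC⁰`
circuits of depth `d₀` and `n^k` wires then for every base `1 < c′ < e^{1/((k+1)(d₀+1))}` and every
sufficiently large depth `d` it has `TC⁰` circuits of depth `d` and `⌊n^{1+(c′)^{−d}}⌋` wires
(print, functional version: "`c = e^{1/(k·d₀)}` … for any `c′ < e^{1/(k·d₀)}`, for every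
sufficiently large `d`"; the shift `(d₀, k) ↦ (d₀+1, k+1)` is the decision-to-functional
conversion of the module docstring, item 1). Named fact. Hypothesis AND conclusion are read in the
almost-everywhere class `TCdWIRESae`; with the weaker (a.e.) hypothesis the statement is implied by
the printed PROOF of Theorem 19 / Corollary 20 (pp. 18–20: the hypothesised circuits are used only
at block lengths `n^{Ω(1)}`), not by the printed every-length statement verbatim — module docstring,
item 3 (referee finding F23). [cite: ChenTell2019, Cor. 21 (p. 20); proof via Thm. 19 / Cor. 20 (pp. 18–20)] -/
def cor21 (L : Language Bool) : Prop :=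
  ∀ d₀ k : ℕ, (L ∈ TCdWIRESae d₀ fun n => n ^ k) →
    ∀ c' : ℝ, 1 < c' → c' < Real.exp (1 / (((k : ℝ) + 1) * ((d₀ : ℝ) + 1))) →
      ∃ D : ℕ, ∀ d ≥ D, L ∈ TCdWIRESae d (wireBound c' d)

/-- **[ChenTell2019, Corollary 21] for `W_{S5}`**, every injective encoding. Named fact; a.e.
rendering implied by the printed proof (Thm. 19 / Cor. 20), module docstring item 3.
[cite: ChenTell2019, Cor. 21 (p. 20, Π = W_{S5}); proof via Thm. 19 / Cor. 20 (pp. 18–20)] -/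
def cor21_WS5 : Prop := ∀ Bin : S5 ↪ (Fin 7 → Bool), cor21 (WS5 Bin)

/-- Theorem 2 is the contrapositive of Corollary 21 with the constant made existential ("Working
out the precise parameters underlying Theorem 2 (see Corollary 21)", p. 5): `cor21 Π → thm2 Π`,
with `c := e^{1/(2(k+1)(d₀+1))}`. [cite: ChenTell2019, p. 5 (Thm. 2 from Cor. 21)] -/
theorem thm2_of_cor21 {L : Language Bool} (h : cor21 L) : thm2 L := by
  intro d₀ k
  set A : ℝ := 1 / (((k : ℝ) + 1) * ((d₀ : ℝ) + 1)) with hA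
  have hApos : 0 < A := by positivity
  refine ⟨Real.exp (A / 2), Real.one_lt_exp_iff.2 (by positivity), fun hH hmem => ?_⟩
  obtain ⟨D, hD⟩ := h d₀ k hmem (Real.exp (A / 2)) (Real.one_lt_exp_iff.2 (by positivity))
    (Real.exp_lt_exp.2 (by linarith))
  obtain ⟨d, hd, hnot⟩ := hH D
  exact hnot (hD d hd)

/-- `HardAtBase` is monotone in the base: a larger base is a smaller wire bound, hence a smaller
class to be outside of. [folklore] -/
theorem HardAtBase.mono {L : Language Bool} {c c' : ℝ} (hc : 1 ≤ c) (hcc' : c ≤ c')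
    (h : HardAtBase L c) : HardAtBase L c' := by
  intro D
  obtain ⟨d, hd, hnot⟩ := h D
  refine ⟨d, hd, fun hmem => hnot (TCdWIRESae_mono d ⟨1, fun n hn => ?_⟩ hmem)⟩
  have hn : (1 : ℝ) ≤ n := by exact_mod_cast hn
  have hc0 : 0 < c := by linarith
  refine Nat.floor_le_floor (Real.rpow_le_rpow_of_exponent_le hn ?_)
  have : c'⁻¹ ^ d ≤ c⁻¹ ^ d :=
    pow_le_pow_left₀ (inv_nonneg.2 (by linarith)) (inv_anti₀ hc0 hcc') d
  linarith

/-! ### The Impagliazzo–Paturi–Saks sequence `ν` and their parity bound (known side) -/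

/-- The IPS sequence `ν`: `ν₁ = 1`, `ν₂ = 3`, `ν_{i+2} = 2ν_{i+1} + νᵢ` (`1, 3, 7, 17, 41, 99, …`;
`ν₀ := 1` extends the recurrence backwards and is not used).
[cite: ImpagliazzoPaturiSaks1997, §6 (p. 703, definition of νᵢ)] -/
def nu : ℕ → ℕ
  | 0 => 1
  | 1 => 1
  | n + 2 => 2 * nu (n + 1) + nu n

/-- `ν₀ = 1` (backward extension). [folklore] -/
@[simp] theorem nu_zero : nu 0 = 1 := rfl
/-- `ν₁ = 1`. [cite: ImpagliazzoPaturiSaks1997, §6 (p. 703)] -/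
@[simp] theorem nu_one : nu 1 = 1 := rfl
/-- The recurrence `ν_{i+2} = 2ν_{i+1} + νᵢ`. [cite: ImpagliazzoPaturiSaks1997, §6 (p. 703)] -/
theorem nu_add_two (n : ℕ) : nu (n + 2) = 2 * nu (n + 1) + nu n := rfl
/-- `ν₂ = 3`. [cite: ImpagliazzoPaturiSaks1997, §6 (p. 703)] -/
@[simp] theorem nu_two : nu 2 = 3 := rfl
/-- `ν₃ = 7`. [folklore] -/
@[simp] theorem nu_three : nu 3 = 7 := rfl
/-- `ν₄ = 17`. [folklore] -/
@[simp] theorem nu_four : nu 4 = 17 := rfl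

/-- `ν` is nondecreasing. [folklore] -/
theorem nu_le_succ : ∀ n : ℕ, nu n ≤ nu (n + 1)
  | 0 => le_rfl
  | n + 1 => by rw [nu_add_two]; omega

/-- `ν` is monotone. [folklore] -/
theorem nu_mono : Monotone nu := monotone_nat_of_le_succ nu_le_succ

/-- `ν_d ≥ 3` for `d ≥ 2`. [folklore] -/
theorem three_le_nu {d : ℕ} (hd : 2 ≤ d) : 3 ≤ nu d := nu_two ▸ nu_mono hd

/-- The closed form `ν_n = ((1+√2)ⁿ + (1−√2)ⁿ)/2` ("the explicit expression for νᵢ is of the form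
`A(1+√2)^i + B(1−√2)^i`"). [cite: ImpagliazzoPaturiSaks1997, §6 (p. 703)] -/
theorem nu_closed (n : ℕ) : (nu n : ℝ) = ((1 + √2) ^ n + (1 - √2) ^ n) / 2 := by
  induction n using Nat.twoStepInduction with
  | zero => simp
  | one => simp
  | more n ih1 ih2 =>
    rw [nu_add_two]; push_cast; rw [ih1, ih2]
    have h2 : √2 ^ 2 = (2 : ℝ) := Real.sq_sqrt (by norm_num)
    linear_combination (-((1 + √2) ^ n + (1 - √2) ^ n) / 2) * h2

/-- `|1 − √2| ≤ 1`. [folklore] -/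
theorem abs_one_sub_sqrt_two_le : |(1 : ℝ) - √2| ≤ 1 := by
  have h1 : (1 : ℝ) < √2 := by
    rw [show (1 : ℝ) = √1 from Real.sqrt_one.symm]; exact Real.sqrt_lt_sqrt (by norm_num) (by norm_num)
  have h2 : √2 < (2 : ℝ) := by
    rw [show (2 : ℝ) = √4 by rw [show (4 : ℝ) = 2 ^ 2 by norm_num, Real.sqrt_sq (by norm_num)]]
    exact Real.sqrt_lt_sqrt (by norm_num) (by norm_num)
  rw [abs_le]; constructor <;> linarith

/-- `ν_n ≤ (1+√2)ⁿ`. [folklore] -/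
theorem nu_le_pow (n : ℕ) : (nu n : ℝ) ≤ (1 + √2) ^ n := by
  rw [nu_closed]
  have h : |((1 : ℝ) - √2) ^ n| ≤ 1 := by
    rw [abs_pow]; exact pow_le_one₀ (abs_nonneg _) abs_one_sub_sqrt_two_le
  have hB : ((1 : ℝ) - √2) ^ n ≤ 1 := (abs_le.1 h).2
  have hA : (1 : ℝ) ≤ (1 + √2) ^ n := one_le_pow₀ (by have := Real.sqrt_nonneg 2; linarith)
  linarith

/-- `(1+√2)ⁿ ≤ 2ν_n + 1`. [folklore] -/
theorem pow_le_two_nu_add_one (n : ℕ) : (1 + √2) ^ n ≤ 2 * nu n + 1 := by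
  rw [nu_closed]
  have h : |((1 : ℝ) - √2) ^ n| ≤ 1 := by
    rw [abs_pow]; exact pow_le_one₀ (abs_nonneg _) abs_one_sub_sqrt_two_le
  have hB : -1 ≤ ((1 : ℝ) - √2) ^ n := (abs_le.1 h).1
  linarith

/-- **[ImpagliazzoPaturiSaks1997, Corollary 4]** in the tree's model (module docstring, item 5):
for `n ≥ 11`, `d ≥ 2`, every circuit over linear threshold gates with `acDepth ≤ d` computing the
parity of `n` bits has `(n/11)^{1+1/(ν_d−1)} ≤ 2·d·wires`. Print: "Any threshold circuit of depth
`d ≥ 2` that computes parity of `n` variables has at least `(n/11)^{1+1/(ν_d−1)}` edges" (layered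
circuits; "an arbitrary threshold circuit can be converted to a layered one … increasing the number
of edges by a factor of at most `d`"). Named fact (proved in print; not re-proved here).
[cite: ImpagliazzoPaturiSaks1997, Cor. 4 (p. 703)] -/
def ips97_cor4 : Prop :=
  ∀ n d : ℕ, 11 ≤ n → 2 ≤ d → ∀ C : Circuit (Fin n), C.IsOver ltfBasis → C.acDepth ≤ d →
    (∀ x, C.eval x = parityFn n x) →
      ((n : ℝ) / 11) ^ (1 + 1 / ((nu d : ℝ) - 1)) ≤ 2 * d * (C.wires : ℝ)

/-! ### A concrete encoding and the linear reduction from parity (known side, proved) -/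

/-- The transposition `(0 1) ∈ S₅`. [folklore] -/
def τ : S5 := Equiv.swap 0 1

/-- `τ ≠ 1`. [folklore] -/
theorem τ_ne_one : τ ≠ 1 := by
  rw [τ, Ne, Equiv.swap_eq_one_iff]; decide

/-- `τ² = 1`. [folklore] -/
theorem τ_sq : τ ^ 2 = 1 := by
  rw [τ, sq]; exact Equiv.swap_mul_self 0 1

/-- `τ` has order `2`. [folklore] -/
theorem orderOf_τ : orderOf τ = 2 :=
  haveI : Fact (Nat.Prime 2) := ⟨Nat.prime_two⟩
  orderOf_eq_prime τ_sq τ_ne_one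

/-- `|S₅| = 120 ≤ 128 = |{0,1}⁷|`. [folklore] -/
theorem card_S5_le : Fintype.card S5 ≤ Fintype.card (Fin 7 → Bool) := by
  rw [card_S5]; simp

/-- Some injective `7`-bit encoding of `S₅` (`120 ≤ 128`). [folklore] -/
def someCode : S5 ↪ (Fin 7 → Bool) :=
  Classical.choice (Function.Embedding.nonempty_of_card_le card_S5_le)

/-- **The encoding `bin₀`**: an injective `Bin : S₅ ↪ {0,1}⁷` with `Bin 1 = 1⁷` and
`Bin τ = 0⁷` (obtained from any code by two value swaps). [folklore] -/
def bin₀ : S5 ↪ (Fin 7 → Bool) :=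
  (someCode.setValue 1 fun _ => true).setValue τ fun _ => false

/-- `bin₀ τ = 0⁷`. [folklore] -/
@[simp] theorem bin₀_τ : bin₀ τ = fun _ => false := Function.Embedding.setValue_eq _ _ _

/-- `bin₀ 1 = 1⁷`. [folklore] -/
@[simp] theorem bin₀_one : bin₀ 1 = fun _ => true := by
  have h1 : (someCode.setValue 1 fun _ => true) 1 = fun _ => true :=
    Function.Embedding.setValue_eq _ _ _
  have hne : (1 : S5) ≠ τ := τ_ne_one.symm
  have hTF : (fun _ : Fin 7 => true) ≠ fun _ => false := by
    intro h; exact Bool.noConfusion (congrFun h 0)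
  show (if (1 : S5) = τ then (fun _ => false) else
    if (someCode.setValue 1 fun _ => true) 1 = (fun _ => false) then
      (someCode.setValue 1 fun _ => true) τ else (someCode.setValue 1 fun _ => true) 1) = _
  rw [if_neg hne, h1, if_neg hTF]

/-- The code of `τ^e`, `e ∈ {0,1}` written as `if b then 0 else 1`, is the constant block `b⁷`.
[folklore] -/
theorem bin₀_pow_ite (b : Bool) : bin₀ (τ ^ (if b then 0 else 1)) = fun _ => b := by
  cases b <;> simp

/-- Division with remainder on `Fin (m·ℓ)`: the index `i·ℓ + j` has quotient `i` and remainder `j`.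
[folklore] -/
theorem divNat_modNat_of_val_eq {m ℓ : ℕ} (i : Fin m) (j : Fin ℓ) (p : Fin (m * ℓ))
    (hp : (p : ℕ) = i * ℓ + j) : p.divNat = i ∧ p.modNat = j := by
  have hℓ : 0 < ℓ := Fin.pos j
  constructor
  · ext
    simp only [Fin.coe_divNat, hp]
    rw [Nat.add_div_of_dvd_right (dvd_mul_left ℓ i), Nat.mul_div_cancel _ hℓ, Nat.div_eq_of_lt j.2,
      add_zero]
  · ext
    simp only [Fin.coe_modNat, hp]
    rw [Nat.mul_comm, Nat.mul_add_mod, Nat.mod_eq_of_lt j.2]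

/-- Splitting an input of length `n·7` into `n` blocks of `7`: the string `p ↦ y (p / 7)` is the
concatenation of the constant blocks `(y i)⁷`. [folklore] -/
theorem ofFn_divNat_eq_encode {n : ℕ} (y : Fin n → Bool) :
    List.ofFn (fun p : Fin (n * 7) => y p.divNat) =
      encode bin₀ fun i => τ ^ (if y i then 0 else 1) := by
  rw [encode, List.ofFn_mul]
  refine congrArg List.flatten (List.ofFn_inj.2 (funext fun i => ?_))
  rw [bin₀_pow_ite]
  refine List.ofFn_inj.2 (funext fun j => congrArg y ?_)
  exact (divNat_modNat_of_val_eq i j _ rfl).1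

/-- The length of a code word. [folklore] -/
theorem length_encode {M : Type*} {ℓ : ℕ} (Bin : M → (Fin ℓ → Bool)) {m : ℕ} (g : Fin m → M) :
    (encode Bin g).length = m * ℓ := by
  simp [encode, List.length_flatten, List.map_ofFn, List.sum_ofFn]

/-- A code word as a single `List.ofFn` over `Fin (m·ℓ)`. [folklore] -/
theorem encode_eq_ofFn {M : Type*} {ℓ : ℕ} (Bin : M → (Fin ℓ → Bool)) {m : ℕ} (g : Fin m → M) :
    encode Bin g = List.ofFn fun p : Fin (m * ℓ) => Bin (g p.divNat) p.modNat := by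
  rw [encode, List.ofFn_mul]
  refine congrArg List.flatten (List.ofFn_inj.2 (funext fun i => ?_))
  refine List.ofFn_inj.2 (funext fun j => ?_)
  obtain ⟨h1, h2⟩ := divNat_modNat_of_val_eq i j
    (⟨(i : ℕ) * ℓ + j, _⟩ : Fin (m * ℓ)) rfl
  rw [h1, h2]

/-- Unique parsing: for injective `Bin` and `ℓ ≥ 1`, `encode Bin` is injective in the number of
blocks and the blocks. [folklore] -/
theorem encode_inj {M : Type*} {ℓ : ℕ} (hℓ : 0 < ℓ) {Bin : M → (Fin ℓ → Bool)}
    (hBin : Function.Injective Bin) {m m' : ℕ} {g : Fin m → M} {g' : Fin m' → M}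
    (h : encode Bin g = encode Bin g') : ∃ hm : m = m', ∀ i, g i = g' (Fin.cast hm i) := by
  have hm : m = m' := by
    have := congrArg List.length h
    rw [length_encode, length_encode] at this
    exact Nat.eq_of_mul_eq_mul_right hℓ this
  subst hm
  refine ⟨rfl, fun i => hBin (funext fun j => ?_)⟩
  rw [encode_eq_ofFn, encode_eq_ofFn, List.ofFn_inj] at h
  have hlt : (i : ℕ) * ℓ + j < m * ℓ := by
    have hi := i.2; have hj := j.2
    calc (i : ℕ) * ℓ + j < i * ℓ + ℓ := by omega
      _ = (i + 1) * ℓ := by ring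
      _ ≤ m * ℓ := Nat.mul_le_mul_right _ hi
  obtain ⟨h1, h2⟩ := divNat_modNat_of_val_eq i j (⟨(i : ℕ) * ℓ + j, hlt⟩ : Fin (m * ℓ)) rfl
  have := congrFun h ⟨(i : ℕ) * ℓ + j, hlt⟩
  rwa [h1, h2] at this

/-- Membership of a code word in the monoid problem is the product condition (unique parsing).
[cite: ChenTell2019, §3.2.1 (pairs presentation)] -/
theorem encode_mem_monoidPairs_iff {M : Type*} [Monoid M] {ℓ : ℕ} (hℓ : 0 < ℓ)
    {Bin : M → (Fin ℓ → Bool)} (hBin : Function.Injective Bin) {m : ℕ} (g : Fin (m + 1) → M) :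
    encode Bin g ∈ monoidPairs M ℓ Bin ↔
      (List.ofFn fun i : Fin m => g (Fin.castSucc i)).prod = g (Fin.last m) := by
  refine ⟨?_, fun h => ⟨m, g, rfl, h⟩⟩
  rintro ⟨m', g', hw, hprod⟩
  obtain ⟨hm, hg⟩ := encode_inj hℓ hBin hw
  obtain rfl : m = m' := by omega
  have : g = g' := funext fun i => by simpa using hg i
  subst this
  exact hprod

/-- Products of powers of one element: `∏ᵢ t^{bᵢ} = t^{Σ bᵢ}` (ordered list product, any monoid).
[folklore] -/
theorem prod_ofFn_pow {M : Type*} [Monoid M] (t : M) :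
    ∀ (m : ℕ) (b : Fin m → ℕ), (List.ofFn fun i => t ^ b i).prod = t ^ (∑ i, b i)
  | 0, b => by simp
  | m + 1, b => by
    rw [List.ofFn_succ, List.prod_cons, Fin.sum_univ_succ, pow_add, prod_ofFn_pow t m]

/-- `#ones + #zeros = n`. [folklore] -/
theorem numOnes_add_sum_ite {n : ℕ} (y : Fin n → Bool) :
    GateFn.numOnes y + ∑ i, (if y i then 0 else 1) = n := by
  rw [GateFn.numOnes, Finset.card_filter, ← Finset.sum_add_distrib]
  have : ∀ i ∈ (univ : Finset (Fin n)), ((if y i = true then 1 else 0) + if y i then 0 else 1) = 1 := by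
    intro i _; cases y i <;> simp
  rw [Finset.sum_congr rfl this]; simp

/-- **The reduction computes parity**: for an ODD number `m + 1` of variables, the string with
blocks `(y i)⁷` — i.e. the elements `τ^{¬y₀}, …, τ^{¬y_{m-1}}` with target `τ^{¬y_m}` — is in
`W_{S5}` (encoding `bin₀`) iff `y` has odd parity. [cite: ChenTell2019, p. 5 fn. 5 ("computing
parity can be reduced to computing any of these functions with a linear overhead")] -/
theorem encode_mem_WS5_iff_parity {m : ℕ} (hm : Even m) (y : Fin (m + 1) → Bool) :
    (encode bin₀ fun i => τ ^ (if y i then 0 else 1)) ∈ WS5 bin₀ ↔ parityFn (m + 1) y = true := by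
  rw [WS5, encode_mem_monoidPairs_iff (by norm_num) bin₀.injective]
  rw [prod_ofFn_pow, pow_inj_mod, orderOf_τ, parityFn, decide_eq_true_eq]
  have htot := numOnes_add_sum_ite y
  rw [Fin.sum_univ_castSucc] at htot
  obtain ⟨r, hr⟩ := hm
  omega

/-- Renaming inputs keeps the number of wires. [folklore] -/
theorem wires_mapInputs {ι κ : Type*} (e : ι → κ) (C : Circuit ι) :
    (C.mapInputs e).wires = C.wires := by
  simp only [Circuit.wires, Circuit.mapInputs, GateList.toCircuit, List.map_map]
  rfl

/-- **The known lower bound for `W_{S5}` (wires), from [IPS97] by the linear reduction**: for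
`d ≥ 2`, if `2·d·s((m+1)·7) < ((m+1)/11)^{1+1/(ν_d−1)}` for infinitely many even `m`, then
`W_{S5} ∉ TC_d[s]` (wires, a.e.). Proof: a depth-`d` circuit for `W_{S5}` at length `(m+1)·7`
with its inputs renamed `p ↦ y_{⌊p/7⌋}` computes the parity of `m+1` bits
(`encode_mem_WS5_iff_parity`) with the same wires and depth. [cite: ChenTell2019, p. 5 and fn. 5
(known n^{1+Ω((1+√2)^{−d})} bound for W_{S5} via parity); ImpagliazzoPaturiSaks1997, Cor. 4] -/
theorem WS5_not_mem_of_ips97 (hK : ips97_cor4) {d : ℕ} (hd : 2 ≤ d) {s : ℕ → ℕ}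
    (hs : ∀ N₀ : ℕ, ∃ m ≥ N₀, Even m ∧
      2 * (d : ℝ) * s ((m + 1) * 7) < (((m + 1 : ℕ) : ℝ) / 11) ^ (1 + 1 / ((nu d : ℝ) - 1))) :
    WS5 bin₀ ∉ TCdWIRESae d s := by
  rintro ⟨C, ⟨n₀, hn₀⟩, hdec⟩
  obtain ⟨m, hm, heven, hlt⟩ := hs (max n₀ 10)
  have hm₀ : n₀ ≤ m := le_of_max_le_left hm
  have hm10 : 10 ≤ m := le_of_max_le_right hm
  obtain ⟨hB, hD, hW⟩ := hn₀ ((m + 1) * 7) (by omega)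
  set C' : Circuit (Fin (m + 1)) := (C ((m + 1) * 7)).mapInputs Fin.divNat with hC'
  have hev : ∀ y, C'.eval y = parityFn (m + 1) y := by
    intro y
    rw [hC', Circuit.eval_mapInputs, hdec.eval_eq, ofFn_divNat_eq_encode, Bool.eq_iff_iff,
      ← Set.mem_iff_boolIndicator]
    exact encode_mem_WS5_iff_parity heven y
  have hIPS := hK (m + 1) d (by omega) hd C' (hB.mapInputs _)
    (by rw [hC', Circuit.acDepth_mapInputs]; exact hD) hev
  rw [hC', wires_mapInputs] at hIPS
  have hW' : ((C ((m + 1) * 7)).wires : ℝ) ≤ s ((m + 1) * 7) := by exact_mod_cast hW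
  have hd0 : (0 : ℝ) ≤ 2 * d := by positivity
  nlinarith

/-- **The known bound in exponent form**: for `d ≥ 2` and every `e < 1/(ν_d − 1)`,
`W_{S5} ∉ TC_d[⌊N^{1+e}⌋]` (wires, a.e.), given [IPS97, Cor. 4] — the `n^{1+Ω((1+√2)^{−d})}`
lower bound of [ChenTell2019, p. 5] with its constant located: the admissible exponents are exactly
those below `1/(ν_d − 1) = Θ((1+√2)^{−d})` (`nu_closed`). [cite: ChenTell2019, p. 5 ("TC⁰ circuits
of constant depth d ∈ ℕ require n^{1+Ω(c^{−d})} wires, where c = 1+√2"); ImpagliazzoPaturiSaks1997,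
Cor. 4] -/
theorem WS5_not_mem_rpow_of_ips97 (hK : ips97_cor4) {d : ℕ} (hd : 2 ≤ d) {e : ℝ}
    (he : e < 1 / ((nu d : ℝ) - 1)) :
    WS5 bin₀ ∉ TCdWIRESae d fun N => ⌊(N : ℝ) ^ (1 + e)⌋₊ := by
  refine WS5_not_mem_of_ips97 hK hd fun N₀ => ?_
  set E : ℝ := 1 + 1 / ((nu d : ℝ) - 1) with hE
  have hδ : 0 < E - (1 + e) := by rw [hE]; linarith
  -- the constant to beat: 2d · 7^{1+e} · 11^E < n^{E-(1+e)} eventually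
  set K : ℝ := 2 * d * (7 : ℝ) ^ (1 + e) * (11 : ℝ) ^ E with hK'
  have hev : ∀ᶠ n : ℕ in atTop, K < (n : ℝ) ^ (E - (1 + e)) :=
    ((tendsto_rpow_atTop hδ).comp tendsto_natCast_atTop_atTop).eventually_gt_atTop K
  obtain ⟨N₁, hN₁⟩ := eventually_atTop.1 hev
  refine ⟨2 * max N₀ N₁, by omega, even_two_mul _, ?_⟩
  set n : ℕ := 2 * max N₀ N₁ + 1 with hn
  have hn1 : (1 : ℝ) ≤ n := by exact_mod_cast Nat.succ_le_succ (Nat.zero_le _)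
  have hn0 : (0 : ℝ) < n := by linarith
  have hKn : K < (n : ℝ) ^ (E - (1 + e)) := hN₁ n (by omega)
  have h7 : (0 : ℝ) ≤ 7 := by norm_num
  -- ⌊(n·7)^{1+e}⌋ ≤ 7^{1+e} n^{1+e}
  have hfloor : (⌊(((n * 7 : ℕ) : ℝ)) ^ (1 + e)⌋₊ : ℝ) ≤ (7 : ℝ) ^ (1 + e) * (n : ℝ) ^ (1 + e) := by
    refine (Nat.floor_le (Real.rpow_nonneg (by positivity) _)).trans (le_of_eq ?_)
    push_cast
    rw [mul_comm (n : ℝ) 7, Real.mul_rpow h7 hn0.le]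
  have hsplit : (n : ℝ) ^ E = (n : ℝ) ^ (1 + e) * (n : ℝ) ^ (E - (1 + e)) := by
    rw [← Real.rpow_add hn0]; ring_nf
  have hdiv : ((n : ℝ) / 11) ^ E = (n : ℝ) ^ E / (11 : ℝ) ^ E := Real.div_rpow hn0.le (by norm_num) E
  have h11 : (0 : ℝ) < (11 : ℝ) ^ E := by positivity
  have h7e : (0 : ℝ) < (7 : ℝ) ^ (1 + e) := by positivity
  have hne : (0 : ℝ) < (n : ℝ) ^ (1 + e) := by positivity
  show 2 * (d : ℝ) * (⌊(((n * 7 : ℕ)) : ℝ) ^ (1 + e)⌋₊ : ℝ) < (((n : ℕ) : ℝ) / 11) ^ E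
  rw [hdiv, lt_div_iff₀ h11, hsplit]
  have hd0 : (0 : ℝ) ≤ 2 * d := by positivity
  calc 2 * (d : ℝ) * (⌊(((n * 7 : ℕ)) : ℝ) ^ (1 + e)⌋₊ : ℝ) * (11 : ℝ) ^ E
      ≤ 2 * d * ((7 : ℝ) ^ (1 + e) * (n : ℝ) ^ (1 + e)) * (11 : ℝ) ^ E := by gcongr
    _ = (n : ℝ) ^ (1 + e) * K := by rw [hK']; ring
    _ < (n : ℝ) ^ (1 + e) * (n : ℝ) ^ (E - (1 + e)) := by gcongr

/-! ### Locating the base `1 + √2` (used by the census block) -/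

/-- Above the IPS base nothing is open: for `c > 1 + √2` and `d ≥ 2`, `c^{−d} < 1/(ν_d − 1)`, so
the Chen–Tell wire bound `n^{1+c^{−d}}` is below an IPS-certified one. [folklore] -/
theorem inv_pow_lt_one_div_nu {c : ℝ} (hc : 1 + √2 < c) {d : ℕ} (hd : 2 ≤ d) :
    c⁻¹ ^ d < 1 / ((nu d : ℝ) - 1) := by
  have h3 : (3 : ℝ) ≤ nu d := by exact_mod_cast three_le_nu hd
  have hpos : (0 : ℝ) < 1 + √2 := by have := Real.sqrt_nonneg 2; linarith
  have hc0 : 0 < c := hpos.trans hc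
  have hlt : (nu d : ℝ) - 1 < c ^ d := by
    have := nu_le_pow d
    have : (1 + √2) ^ d < c ^ d := pow_lt_pow_left₀ hc hpos.le (by omega)
    linarith
  rw [inv_pow, ← one_div]
  exact one_div_lt_one_div_of_lt (by linarith) hlt

/-- **Below the IPS base the threshold escapes**: for `1 < c < 1 + √2`, eventually in `d` the
Chen–Tell exponent `c^{−d}` exceeds `1/(ν_d − 1)`, i.e. exceeds every exponent `e` for which
[IPS97] certifies `W_{S5} ∉ TC_d[n^{1+e}]` (`WS5_not_mem_rpow_of_ips97`). [folklore] -/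
theorem eventually_one_div_nu_lt_inv_pow {c : ℝ} (hc1 : 1 < c) (hc : c < 1 + √2) :
    ∀ᶠ d : ℕ in atTop, 1 / ((nu d : ℝ) - 1) < c⁻¹ ^ d := by
  have hpos : (0 : ℝ) < 1 + √2 := by have := Real.sqrt_nonneg 2; linarith
  have hc0 : 0 < c := by linarith
  set r : ℝ := c / (1 + √2) with hr
  set q : ℝ := 1 / (1 + √2) with hq
  have hr0 : 0 ≤ r := by positivity
  have hr1 : r < 1 := (div_lt_one hpos).2 hc
  have hq0 : 0 ≤ q := by positivity
  have hq1 : q < 1 := (div_lt_one hpos).2 (by linarith)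
  have hlim : Tendsto (fun d : ℕ => 2 * r ^ d + 3 * q ^ d) atTop (nhds 0) := by
    have h := ((tendsto_pow_atTop_nhds_zero_of_lt_one hr0 hr1).const_mul 2).add
      ((tendsto_pow_atTop_nhds_zero_of_lt_one hq0 hq1).const_mul 3)
    simpa using h
  have hev : ∀ᶠ d : ℕ in atTop, 2 * r ^ d + 3 * q ^ d < 1 := hlim (gt_mem_nhds one_pos)
  filter_upwards [hev, eventually_ge_atTop 2] with d hd hd2
  have hA : (0 : ℝ) < (1 + √2) ^ d := pow_pos hpos d
  have hrd : r ^ d = c ^ d / (1 + √2) ^ d := by rw [hr, div_pow]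
  have hqd : q ^ d = 1 / (1 + √2) ^ d := by rw [hq, one_div_pow]
  rw [hrd, hqd] at hd
  -- clear denominators: 2 c^d + 3 < (1+√2)^d ≤ 2 ν_d + 1
  have h1 : 2 * c ^ d + 3 < (1 + √2) ^ d := by
    have := mul_lt_mul_of_pos_right hd hA
    rw [one_mul, add_mul, mul_assoc, div_mul_cancel₀ _ hA.ne', mul_assoc, div_mul_cancel₀ _ hA.ne']
      at this
    linarith
  have h2 := pow_le_two_nu_add_one d
  have hlt : c ^ d < (nu d : ℝ) - 1 := by linarith
  rw [inv_pow, ← one_div]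
  exact one_div_lt_one_div_of_lt (pow_pos hc0 d) hlt

/-- Hence, given [IPS97, Cor. 4], the Chen–Tell hypothesis at any base `c > 1 + √2` HOLDS for
`W_{S5}` (encoding `bin₀`): `HardAtBase (WS5 bin₀) c` — the magnification thresholds that matter
are the bases `c ≤ 1 + √2` (Cor. 3: all `c > 1`; Thm. 2/Cor. 21: `c < e^{1/(k d₀)}`).
[cite: ChenTell2019, abstract, p. 1 ("already known, but for a fixed c ≈ 2.41 that is too large");
ImpagliazzoPaturiSaks1997, Cor. 4] -/
theorem hardAtBase_WS5_of_ips97 (hK : ips97_cor4) {c : ℝ} (hc : 1 + √2 < c) :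
    HardAtBase (WS5 bin₀) c := by
  intro D
  refine ⟨max D 2, le_max_left _ _, ?_⟩
  exact WS5_not_mem_rpow_of_ips97 hK (le_max_right _ _) (inv_pow_lt_one_div_nu hc (le_max_right _ _))

/-! ### Non-vacuity -/

/-- The one-block string `1⁷ = bin₀ 1` (no elements, target `1` = the empty product) is in
`W_{S5}`. [folklore] -/
theorem encode_one_mem_WS5 : encode bin₀ (fun _ : Fin 1 => (1 : S5)) ∈ WS5 bin₀ :=
  ⟨0, fun _ => 1, rfl, by simp⟩

/-- `W_{S5}` is a proper, nonempty language: `0⁷ = bin₀ τ` alone is not in it (`τ ≠ 1`).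
[folklore] -/
theorem encode_τ_not_mem_WS5 : encode bin₀ (fun _ : Fin 1 => τ) ∉ WS5 bin₀ := by
  rw [WS5, encode_mem_monoidPairs_iff (by norm_num) bin₀.injective]
  simpa using τ_ne_one.symm

/-- The IPS exponent bound is not vacuous: `1/(ν_d − 1) > 0` for `d ≥ 2`, so
`WS5_not_mem_rpow_of_ips97` yields genuinely superlinear wire bounds (`e > 0` admissible).
[folklore] -/
theorem one_div_nu_pos {d : ℕ} (hd : 2 ≤ d) : 0 < 1 / ((nu d : ℝ) - 1) := by
  have h3 : (3 : ℝ) ≤ nu d := by exact_mod_cast three_le_nu hd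
  exact one_div_pos.2 (by linarith)


end Literature.Computability.MetaComplexity.ChenTell2019
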